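import Summits.QuantumFields.YangMills.Theorems.UnitScaleTiltProp7TrueLinLineBound
import Summits.QuantumFields.YangMills.Theorems.UnitScaleTiltProp7CovHodgeConstraint
import HarnessLib

/-!
# Route `UnitScaleTilt`, crux K1 child «MinimiserStabilityRegPr» (stmt-QuantumFields-19200), line «route-R», growth side — TELESCOPING ALONG AN ARBITRARY LATTICE
# PATH: `‖Y(x,ν) − Ad_{U₀(walk_x w)}Y(x + disp w, ν)‖ ≤ Σ_{steps s} ‖(D_{U₀,dir s}Y_ν)(s₋)‖`, AND THE PAIRING IDENTITY OF THE ODD CROSS TERM (iii)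

Cell `ym3-torus`, twin width seat `ym-routeR-w1` (g3); row (w1-o1′) NAMED by the route-R lead `ym-ust-19200-p1` (g13, bus 2026-08-28T13:33:15Z), the engine under
pieces (ii) (staple transports) and (iii) (reflection pairs) of the three-piece split (`…Prop7WordCommutatorSplit`, `…Walk`, `…Translate`).  THEOREMS ONLY (0 `def`,
0 `sorry`); `--supports stmt-QuantumFields-19200 --as helper`, count-neutral.  YM₃ on T³ is a ladder rung (R3), not the Clay problem; nothing here claims stub S,
row E′, the crux or the gap.

WHY.  Every comparison of two letters of a symmetric (0.4) word — a leg letter with its `Le_μ`-translate read along the staple (piece (ii)), a leg letter with its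
centre-reflection, a segment with its transverse translate (piece (iii), after pairing the offsets `n ↦ −n`) — is a difference `Y(b) − Ad_{U₀(γ)}Y(b′)` of one bond
variable and another of the SAME component transported along a lattice path `γ` from `b₋` to `b′₋`.  Telescoping along the path writes it as a signed, transported sum
of the COVARIANT DIFFERENCES `(D_{U₀,κ}Y_ν)(z) = U₀(z,κ)·Y(z+e_κ,ν)·U₀(z,κ)^* − Y(z,ν)` met along the way ([Balaban1985BackgroundPropagators] (3.3)), forward steps and
backward steps alike (a backward step contributes the same letter read at the step's source, conjugated); transports are isometries, so the norm is at most the `ℓ¹`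
sum of gradient letters along the path — (mass, gradient) currency with the path length as the only constant, and NO corner term (the component `ν` never changes).
For (iii): `[X, S] + [X′, S′] = [X + X′, S] + [X′, S′ − S]` pairs the cross terms of the words at `n` and `−n`; `X + X′` (a leg and its reflection with negated letters) and
`S′ − S` (a segment and its transverse translate) are path-telescoped differences, so the paired cross term is mass × gradient letters too.

WHAT IS PROVED (ns `…Theorems.Prop7WordCommutatorSplitPath`).
* §1 ★★ `norm_sub_transported_along_walk_le` — the title inequality for every word `w` and start `x` (induction on the word; ✓ `B10StarCount.shift_unshift` for
  backward steps); `norm_transported_sub_transported_le` — two-sided form `‖Ad_{g}(Y(x,ν)) − Ad_{g·U₀(walk_x w)}Y(walkEnd, ν)‖ ≤ same sum` (outer transport `g` free).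
* §2 `comm_add_comm_eq_pair` — `[X, S] + [X′, S′] = [X + X′, S] + [X′, S′ − S]`; `norm_comm_pair_le` — `‖[X,S] + [X′,S′]‖ ≤ 2‖X + X′‖·‖S‖ + 2‖X′‖·‖S′ − S‖`.
* §3 `stepDiff_eq_covD` — dictionary: the step letter is `covD (torusT P j) (unitsField (toUField U₀)) κ (Y_ν) z` (✓ `Prop7CovHodgeConstraint.covD_bg_apply`).
HONEST SCOPE.  Exact algebra and the triangle inequality; which paths the consumer telescopes along (staples, reflections, translates) and their multiplicity counts
are not fixed here.

References: T. Bałaban, CMP 109 (1987) 249–301 [Balaban1987RG1] ((0.3)–(0.4) pp.252–253); CMP 99 (1985) 389–434 [Balaban1985BackgroundPropagators] ((3.3) p.390);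
CMP 98 (1985) 17–51 [Balaban1985Averaging] ((56)–(58) p.27).
-/

noncomputable section

open scoped BigOperators Matrix.Norms.L2Operator

namespace Summit.QuantumFields.YangMills.Theorems.Prop7WordCommutatorSplitPath

open Literature.MathematicalPhysics.QuantumFieldTheory.Balaban1983to89
open Finset T4Continuum BlockAveraging AveragingRT ExpMeanLog BlockAveragingEMLLinearised BlockAveragingEMLLinearisedBackground BlockAveragingEMLProp2
open Summit.QuantumFields.YangMills.Theorems.Prop7HolRatioPerStep (norm_coe_eq_one norm_star_coe_eq_one coe_star_mul_self coe_mul_star_self)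
open B10StarCount (shift_unshift)

variable {P : Params} {n : Type*} [Fintype n] [DecidableEq n] [Nonempty n] {j : ℕ}

/-! ## §1 Telescoping along an arbitrary walk -/

/-- Conjugation by an `SU(N)` matrix is norm-non-increasing (local form, product with a star on the right). [folklore] -/
private theorem norm_conj_le' (g : Matrix.specialUnitaryGroup n ℂ) (X : Matrix n n ℂ) :
    ‖(g : Matrix n n ℂ) * X * star (g : Matrix n n ℂ)‖ ≤ ‖X‖ := by
  calc _ ≤ ‖(g : Matrix n n ℂ)‖ * ‖X‖ * ‖star (g : Matrix n n ℂ)‖ := (norm_mul_le _ _).trans (mul_le_mul_of_nonneg_right (norm_mul_le _ _) (norm_nonneg _))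
    _ = ‖X‖ := by rw [norm_coe_eq_one, norm_star_coe_eq_one, one_mul, mul_one]

/-- Conjugation by the star of an `SU(N)` matrix is norm-non-increasing. [folklore] -/
private theorem norm_conj_star_le' (g : Matrix.specialUnitaryGroup n ℂ) (X : Matrix n n ℂ) :
    ‖star (g : Matrix n n ℂ) * X * (g : Matrix n n ℂ)‖ ≤ ‖X‖ := by
  calc _ ≤ ‖star (g : Matrix n n ℂ)‖ * ‖X‖ * ‖(g : Matrix n n ℂ)‖ := (norm_mul_le _ _).trans (mul_le_mul_of_nonneg_right (norm_mul_le _ _) (norm_nonneg _))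
    _ = ‖X‖ := by rw [norm_coe_eq_one, norm_star_coe_eq_one, one_mul, mul_one]

/-- ★★ **TELESCOPING ALONG AN ARBITRARY LATTICE PATH**: for every word `w` and start `x`,
`‖Y(x,ν) − U₀(walk_x w)·Y(walkEnd_x w, ν)·U₀(walk_x w)^*‖ ≤ Σ_{s ∈ walk_x w} ‖U₀(s.bond)·Y(s.bond₊, ν)·U₀(s.bond)^* − Y(s.bond₋, ν)‖` — a bond variable and a
same-component one transported back along the path differ by the covariant differences `D_{U₀,dir s}Y_ν` met along the path (forward and backward steps alike),
each counted once. [cite: Balaban1985BackgroundPropagators, (3.3) p.390; Balaban1985Averaging, (58) p.27] -/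
theorem norm_sub_transported_along_walk_le (U₀ : GaugeField P j (Matrix.specialUnitaryGroup n ℂ)) (Y : PBond P j → Matrix n n ℂ) (ν : Fin P.d) :
    ∀ (w : List (Letter P.d)) (x : Site P j),
      ‖Y ⟨x, ν⟩ - ((holAt U₀ (walk x w) : Matrix.specialUnitaryGroup n ℂ) : Matrix n n ℂ) * Y ⟨walkEnd x w, ν⟩
          * star ((holAt U₀ (walk x w) : Matrix.specialUnitaryGroup n ℂ) : Matrix n n ℂ)‖
        ≤ ((walk x w).map fun s : LStep P j =>
            ‖((U₀ s.bond : Matrix.specialUnitaryGroup n ℂ) : Matrix n n ℂ) * Y ⟨s.bond.tgt, ν⟩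
                * star ((U₀ s.bond : Matrix.specialUnitaryGroup n ℂ) : Matrix n n ℂ) - Y ⟨s.bond.src, ν⟩‖).sum
  | [], x => by simp [walk, walkEnd, holAt_nil]
  | (κ, true) :: w, x => by
    have ih := norm_sub_transported_along_walk_le U₀ Y ν w (x.shift κ)
    simp only [walk, walkEnd, holAt_cons, if_true, List.map_cons, List.sum_cons, Submonoid.coe_mul, star_mul]
    -- `Y − (U H) Y_end (H^* U^*) = (Y − U Y′ U^*) + U (Y′ − H Y_end H^*) U^*`
    set U : Matrix n n ℂ := ((U₀ ⟨x, κ⟩ : Matrix.specialUnitaryGroup n ℂ) : Matrix n n ℂ) with hU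
    set H : Matrix n n ℂ := ((holAt U₀ (walk (x.shift κ) w) : Matrix.specialUnitaryGroup n ℂ) : Matrix n n ℂ) with hH
    have e : Y ⟨x, ν⟩ - U * H * Y ⟨walkEnd (x.shift κ) w, ν⟩ * (star H * star U)
        = -(U * Y ⟨x.shift κ, ν⟩ * star U - Y ⟨x, ν⟩) + U * (Y ⟨x.shift κ, ν⟩ - H * Y ⟨walkEnd (x.shift κ) w, ν⟩ * star H) * star U := by
      noncomm_ring
    rw [e]
    calc _ ≤ ‖-(U * Y ⟨x.shift κ, ν⟩ * star U - Y ⟨x, ν⟩)‖ + ‖U * (Y ⟨x.shift κ, ν⟩ - H * Y ⟨walkEnd (x.shift κ) w, ν⟩ * star H) * star U‖ := norm_add_le _ _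
      _ ≤ ‖U * Y ⟨x.shift κ, ν⟩ * star U - Y ⟨x, ν⟩‖ + ‖Y ⟨x.shift κ, ν⟩ - H * Y ⟨walkEnd (x.shift κ) w, ν⟩ * star H‖ := by
          rw [norm_neg]
          exact add_le_add le_rfl (norm_conj_le' _ _)
      _ ≤ _ := add_le_add le_rfl ih
  | (κ, false) :: w, x => by
    have ih := norm_sub_transported_along_walk_le U₀ Y ν w (x.unshift κ)
    simp only [walk, walkEnd, holAt_cons, Bool.false_eq_true, if_false, List.map_cons, List.sum_cons, Submonoid.coe_mul, star_mul]
    have hinv : (((U₀ ⟨x.unshift κ, κ⟩)⁻¹ : Matrix.specialUnitaryGroup n ℂ) : Matrix n n ℂ)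
        = star ((U₀ ⟨x.unshift κ, κ⟩ : Matrix.specialUnitaryGroup n ℂ) : Matrix n n ℂ) := rfl
    rw [hinv, star_star]
    set U : Matrix n n ℂ := ((U₀ ⟨x.unshift κ, κ⟩ : Matrix.specialUnitaryGroup n ℂ) : Matrix n n ℂ) with hU
    set H : Matrix n n ℂ := ((holAt U₀ (walk (x.unshift κ) w) : Matrix.specialUnitaryGroup n ℂ) : Matrix n n ℂ) with hH
    have htgt : (⟨x.unshift κ, κ⟩ : PBond P j).tgt = x := shift_unshift x κ
    rw [htgt]
    -- `Y − (U^* H) Y_end (H^* U) = U^* (U Y U^* − Y′) U + U^* (Y′ − H Y_end H^*) U`, using `U^* U = 1`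
    have e : Y ⟨x, ν⟩ - star U * H * Y ⟨walkEnd (x.unshift κ) w, ν⟩ * (star H * U)
        = star U * (U * Y ⟨x, ν⟩ * star U - Y ⟨x.unshift κ, ν⟩) * U
          + star U * (Y ⟨x.unshift κ, ν⟩ - H * Y ⟨walkEnd (x.unshift κ) w, ν⟩ * star H) * U := by
      have hSU : star U * U = 1 := coe_star_mul_self _
      have hY : Y ⟨x, ν⟩ = star U * (U * Y ⟨x, ν⟩ * star U) * U := by
        rw [show star U * (U * Y ⟨x, ν⟩ * star U) * U = (star U * U) * Y ⟨x, ν⟩ * (star U * U) by noncomm_ring, hSU, one_mul, mul_one]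
      conv_lhs => rw [hY]
      noncomm_ring
    rw [e]
    calc _ ≤ ‖star U * (U * Y ⟨x, ν⟩ * star U - Y ⟨x.unshift κ, ν⟩) * U‖
          + ‖star U * (Y ⟨x.unshift κ, ν⟩ - H * Y ⟨walkEnd (x.unshift κ) w, ν⟩ * star H) * U‖ := norm_add_le _ _
      _ ≤ ‖U * Y ⟨x, ν⟩ * star U - Y ⟨x.unshift κ, ν⟩‖ + ‖Y ⟨x.unshift κ, ν⟩ - H * Y ⟨walkEnd (x.unshift κ) w, ν⟩ * star H‖ :=
          add_le_add (norm_conj_star_le' _ _) (norm_conj_star_le' _ _)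
      _ ≤ _ := add_le_add le_rfl ih

/-- **TWO-SIDED FORM** (outer transport free): `‖g·Y(x,ν)·g^* − (g·U₀(walk_x w))·Y(walkEnd_x w, ν)·(g·U₀(walk_x w))^*‖ ≤` the same path sum — the shape met inside a
longer word, where the path's letters are already transported by the holonomy `g` of a prefix. [cite: Balaban1985Averaging, (58) p.27] -/
theorem norm_transported_sub_transported_le (U₀ : GaugeField P j (Matrix.specialUnitaryGroup n ℂ)) (Y : PBond P j → Matrix n n ℂ) (ν : Fin P.d)
    (g : Matrix.specialUnitaryGroup n ℂ) (w : List (Letter P.d)) (x : Site P j) :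
    ‖(g : Matrix n n ℂ) * Y ⟨x, ν⟩ * star (g : Matrix n n ℂ)
        - ((g * holAt U₀ (walk x w) : Matrix.specialUnitaryGroup n ℂ) : Matrix n n ℂ) * Y ⟨walkEnd x w, ν⟩
          * star ((g * holAt U₀ (walk x w) : Matrix.specialUnitaryGroup n ℂ) : Matrix n n ℂ)‖
      ≤ ((walk x w).map fun s : LStep P j =>
          ‖((U₀ s.bond : Matrix.specialUnitaryGroup n ℂ) : Matrix n n ℂ) * Y ⟨s.bond.tgt, ν⟩
              * star ((U₀ s.bond : Matrix.specialUnitaryGroup n ℂ) : Matrix n n ℂ) - Y ⟨s.bond.src, ν⟩‖).sum := by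
  rw [Submonoid.coe_mul, star_mul]
  have e : (g : Matrix n n ℂ) * Y ⟨x, ν⟩ * star (g : Matrix n n ℂ)
        - (g : Matrix n n ℂ) * ((holAt U₀ (walk x w) : Matrix.specialUnitaryGroup n ℂ) : Matrix n n ℂ) * Y ⟨walkEnd x w, ν⟩
          * (star ((holAt U₀ (walk x w) : Matrix.specialUnitaryGroup n ℂ) : Matrix n n ℂ) * star (g : Matrix n n ℂ))
      = (g : Matrix n n ℂ) * (Y ⟨x, ν⟩ - ((holAt U₀ (walk x w) : Matrix.specialUnitaryGroup n ℂ) : Matrix n n ℂ) * Y ⟨walkEnd x w, ν⟩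
          * star ((holAt U₀ (walk x w) : Matrix.specialUnitaryGroup n ℂ) : Matrix n n ℂ)) * star (g : Matrix n n ℂ) := by
    noncomm_ring
  rw [e]
  exact (norm_conj_le' _ _).trans (norm_sub_transported_along_walk_le U₀ Y ν w x)

/-! ## §2 The pairing identity for the odd cross term (iii) -/

omit [Nonempty n] in
/-- **`[X, S] + [X′, S′] = [X + X′, S] + [X′, S′ − S]`** — pairing the cross terms `[ΣF + ΣF′, ΣS]` of the words at the offsets `n` and `−n`: `X + X′` is a leg and its
reflection (negated letters), `S′ − S` a segment and its transverse translate. [cite: Balaban1987RG1, (0.4) p.253] -/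
theorem comm_add_comm_eq_pair (X S X' S' : Matrix n n ℂ) :
    (X * S - S * X) + (X' * S' - S' * X') = ((X + X') * S - S * (X + X')) + (X' * (S' - S) - (S' - S) * X') := by
  noncomm_ring

omit [Nonempty n] in
/-- `‖ab − ba‖ ≤ 2‖a‖‖b‖` (local copy of the commutator bound). [folklore] -/
private theorem norm_comm_le' (a b : Matrix n n ℂ) : ‖a * b - b * a‖ ≤ 2 * ‖a‖ * ‖b‖ := by
  calc ‖a * b - b * a‖ ≤ ‖a * b‖ + ‖b * a‖ := norm_sub_le _ _
    _ ≤ ‖a‖ * ‖b‖ + ‖b‖ * ‖a‖ := add_le_add (norm_mul_le _ _) (norm_mul_le _ _)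
    _ = 2 * ‖a‖ * ‖b‖ := by ring

omit [Nonempty n] in
/-- **THE PAIRED CROSS TERM IS MASS × DIFFERENCES**: `‖[X,S] + [X′,S′]‖ ≤ 2‖X + X′‖·‖S‖ + 2‖X′‖·‖S′ − S‖`. [cite: Balaban1987RG1, (0.4) p.253] -/
theorem norm_comm_pair_le (X S X' S' : Matrix n n ℂ) :
    ‖(X * S - S * X) + (X' * S' - S' * X')‖ ≤ 2 * ‖X + X'‖ * ‖S‖ + 2 * ‖X'‖ * ‖S' - S‖ := by
  rw [comm_add_comm_eq_pair]
  exact (norm_add_le _ _).trans (add_le_add (norm_comm_le' _ _) (norm_comm_le' _ _))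

/-! ## §3 Dictionary: the step letter is `covD` of [Balaban1985BackgroundPropagators] (3.3) in the tree's letters -/

/-- **`U₀(b)·Y(b₊, ν)·U₀(b)^* − Y(b₋, ν) = (D_{U₀,μ_b}Y_ν)(b₋)`** (✓ `Prop7CovHodgeConstraint.covD_bg_apply` with `φ := Y_ν`): every summand of §1 is an entry of the covariant
gradient form of ✓ `Prop7CovariantWeitzenbock.sum_covD_sq_le_curl_sq_add_divB_sq`. [cite: Balaban1985BackgroundPropagators, (3.3) p.390] -/
theorem stepDiff_eq_covD {N : ℕ} [NeZero N] (U₀ : GaugeField P j (Matrix.specialUnitaryGroup (Fin N) ℂ)) (Y : PBond P j → Matrix (Fin N) (Fin N) ℂ)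
    (b : PBond P j) (ν : Fin P.d) :
    ((U₀ b : Matrix.specialUnitaryGroup (Fin N) ℂ) : Matrix (Fin N) (Fin N) ℂ) * Y ⟨b.tgt, ν⟩
        * star ((U₀ b : Matrix.specialUnitaryGroup (Fin N) ℂ) : Matrix (Fin N) (Fin N) ℂ) - Y ⟨b.src, ν⟩
      = B9Eq39Adjoint.covD (B9TorusCalculus.torusT P j) (fun κ z => B10Eq27TorusAxialLog.unitsField (B10Eq27TorusAxialLog.toUField U₀) ⟨z, κ⟩) b.dir
          (fun z => Y ⟨z, ν⟩) b.src :=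
  (Prop7CovHodgeConstraint.covD_bg_apply U₀ (fun z => Y ⟨z, ν⟩) b).symm

end Summit.QuantumFields.YangMills.Theorems.Prop7WordCommutatorSplitPath

end
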